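import Mathlib
import Literature.NumberTheory.Irrationality.BrownZudilin2022.GeneralFamily
import Literature.NumberTheory.Irrationality.BrownZudilin2022.CubicalForm
import Literature.NumberTheory.Irrationality.BrownZudilin2022.BarnesRepresentation
import Summits.KontsevichZagierPeriods.Zeta5Search.WedgeDictionaryKernel
import Summits.KontsevichZagierPeriods.Zeta5Search.WedgeDictionaryKernelUniformA
import Summits.KontsevichZagierPeriods.Zeta5Search.WedgeDictionaryKernelCells

/-!
# UNIFORM VALUE theorems for ALL corner classes of gen-1's dictionary, levels ≥ 6 — part A: families `T11`, `G7` (cell `pub-zeta5`, lineage gen-1, g20)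

HONEST FRAMING: systematic search; no irrationality claim unless certified.  Structure of the open node
`WedgeDictionary.explicitPQ` only; nothing is evaluated; nothing about linear forms or ζ(5).

OUR work (Summit side; generator `code/gen1/g20/symvalue.py`).  For each of the five corner families of
`WedgeDictionaryKernelUniform.lean` — `T11` (tower), `G7` (generic), `E6` (edge y = 0), `P11` ((1,1)), `Z7` ((0,0)) — and for ALL
integer parameters in the family's domain (hypotheses `hh`, `hXY`, …), the cellular integral of the corner class
`a_T(h,X,Y)` equals an explicit ℚ(h,X,Y)-combination, weighted by ratios of Barnes prefactors `barnesPrefactor`, of the cellular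
integrals of the family's NON-corner support points, GIVEN Brown–Zudilin (8),(10),(16) as hypotheses
(`cellularIntegral_eq_cubicalIntegral`, `cubicalIntegral_eq_Jintegral`, `barnes_double`); no hypergeometric input (H1) and no
invariance (27) is used.  Each theorem is `WedgeDictionaryKernel.corner_of_certificate` fed with (i) the affine parameter
vectors and letters (convergence, `pOf`/`qOf`, non-negativity and the chamber inequalities at the reference contour
`(3/5, 7/10)` + shifts proved symbolically by `simp`/`omega`/`linarith`) and (ii) the uniform kernel identity `kernel_<F>` (its
finitely many excluded hyperplanes miss the contour because their real parts are non-integers).  Levels 2 and 4 (h = 1, 2) are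
covered by the cell's fixed-data certificates.  What this does NOT do: it does not evaluate the non-corner integrals (that is the
non-corner conjunct of `explicitPQ`, reduced in the tree to the cellular relation families, `Rows.explicitPQ_of_cells4`), and it
does not yet check that the dictionary's closed form satisfies the same five relations identically in `h, X, Y` (successor step M4).
Imports `WedgeDictionaryKernel.lean` (master lemma), `WedgeDictionaryKernelUniformA.lean` (the kernel identities) and
`WedgeDictionaryKernelCells.lean` (helpers `chamberQ_intro`, `ne_zero_of_re_ne`).  Split for the 400-line limit into part A (`T11`, `G7`) and
part B (`E6`, `P11`, `Z7`); each family block is g20's farm-checked text (gen-1 g21 re-staging: helper copies replaced by the shared ones,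
docstrings added), re-checked on the farm in staged files that inline the three imports.
-/

set_option maxHeartbeats 8000000
set_option linter.unusedSimpArgs false
set_option linter.unusedTactic false
set_option linter.unreachableTactic false
set_option linter.style.longLine false
set_option linter.unusedVariables false

/-! ## Family `T11` -/

namespace Summit.KontsevichZagierPeriods.Zeta5Search.WedgeDictionary.KernelUniform.T11Value

open Literature.NumberTheory.Irrationality.BrownZudilin2022
open Summit.KontsevichZagierPeriods.Zeta5Search.WedgeDictionary.Kernel
open Summit.KontsevichZagierPeriods.Zeta5Search.WedgeDictionary.KernelUniform.T11
open Summit.KontsevichZagierPeriods.Zeta5Search.WedgeDictionary.KernelCells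

/-- Target: the corner class of family `T11` as an affine parameter vector `a(h)`. -/
def aT (h : ℤ) : Fin 8 → ℤ := ![0, h, 0, h, 0, 0, h, 0]
/-- Its letters. -/
def pT (h : ℤ) : Fin 7 → ℤ := ![0, 0, 0, h, h, 0, 0]
/-- The `q`-letters of the family's corner target. -/
def qT (h : ℤ) : Fin 5 → ℤ := ![h, 0, 0, 0, h]
/-- The 11 support points (non-corner family points), their letters and contour shifts. -/
def av (h : ℤ) : Fin 11 → Fin 8 → ℤ := ![![1, h - 1, 0, h - 1, 0, 1, h - 1, 1], ![0, h - 1, 1, h - 2, 1, 1, h - 1, 2], ![1, h - 1, 1, h - 1, 1, 1, h - 1, 2], ![1, h - 1, 1, h - 1, 1, 0, h - 1, 1], ![1, h - 1, 1, h - 1, 0, 0, h, 0], ![0, h, 0, h - 1, 1, 1, h, 1], ![2, h - 1, 1, h, 0, 0, h - 1, 0], ![2, h - 1, 1, h, 0, 0, h - 2, 0], ![1, h, 0, h, 0, 1, h - 1, 1], ![1, h, 0, h, 0, 1, h - 2, 1], ![0, h, 1, h - 1, 1, 1, h - 1, 2]]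
/-- The `p`-letters of the support points. -/
def pv (h : ℤ) : Fin 11 → Fin 7 → ℤ := ![![0, 0, 1, h - 1, h - 1, 0, 1], ![0, 1, 1, h - 1, h - 1, 0, 0], ![0, 0, 1, h - 1, h - 1, 0, 0], ![0, 0, 0, h - 1, h - 1, 0, 0], ![0, 1, 0, h, h, 1, 1], ![1, 1, 1, h, h, 0, 1], ![0, 0, 0, h, h - 1, 1, 1], ![0, 0, 0, h, h - 2, 1, 1], ![0, 0, 1, h, h - 1, 0, 1], ![0, 0, 1, h, h - 2, 0, 1], ![0, 1, 1, h, h - 1, 0, 0]]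
/-- The `q`-letters of the support points. -/
def qv (h : ℤ) : Fin 11 → Fin 5 → ℤ := ![![h - 1, 0, 1, 1, h - 1], ![h - 2, 1, 0, 0, h - 1], ![h - 1, 1, 1, 1, h - 1], ![h - 1, 1, 1, 1, h - 1], ![h - 1, 0, 0, 1, h - 1], ![h - 1, 1, 1, 0, h], ![h, 0, 1, 2, h - 1], ![h, 0, 1, 2, h - 1], ![h, 0, 1, 1, h], ![h, 0, 1, 1, h], ![h - 1, 1, 0, 0, h]]
/-- First-variable contour shifts of the support kernels. -/
def n1v : Fin 11 → ℤ := ![0, 0, 0, 0, 0, 1, 0, 0, 0, 0, 0]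
/-- Second-variable contour shifts of the support kernels. -/
def n2v : Fin 11 → ℤ := ![0, 0, 0, 0, 1, 0, 1, 0, 0, 0, 0]
/-- Certificate coefficients `ρᵢ(h) ∈ ℚ(h)`. -/
def ρv (h : ℤ) : Fin 11 → ℚ := ![(((-12 : ℚ) + (36 : ℚ) * (h : ℚ) + (-48 : ℚ) * (h : ℚ) ^ 2 + (18 : ℚ) * (h : ℚ) ^ 3) / ((6 : ℚ) * ((h : ℚ)) * ((h : ℚ)) * ((h : ℚ) - 2))), (((-12 : ℚ) * (h : ℚ) + (24 : ℚ) * (h : ℚ) ^ 2 + (-15 : ℚ) * (h : ℚ) ^ 3 + (3 : ℚ) * (h : ℚ) ^ 4) / ((6 : ℚ) * ((h : ℚ)) * ((h : ℚ)) * ((h : ℚ) - 2))), (((-72 : ℚ) + (144 : ℚ) * (h : ℚ) + (-90 : ℚ) * (h : ℚ) ^ 2 + (18 : ℚ) * (h : ℚ) ^ 3) / ((6 : ℚ) * ((h : ℚ)) * ((h : ℚ)) * ((h : ℚ) - 2))), (((24 : ℚ) * (h : ℚ) + (-24 : ℚ) * (h : ℚ) ^ 2 + (6 : ℚ) * (h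 : ℚ) ^ 3) / ((6 : ℚ) * ((h : ℚ)) * ((h : ℚ)) * ((h : ℚ) - 2))), (((12 : ℚ) * (h : ℚ) + (-12 : ℚ) * (h : ℚ) ^ 2 + (-3 : ℚ) * (h : ℚ) ^ 3 + (3 : ℚ) * (h : ℚ) ^ 4) / ((6 : ℚ) * ((h : ℚ)) * ((h : ℚ)) * ((h : ℚ) - 2))), (((-12 : ℚ) + (12 : ℚ) * (h : ℚ) + (-12 : ℚ) * (h : ℚ) ^ 2 + (6 : ℚ) * (h : ℚ) ^ 3) / ((6 : ℚ) * ((h : ℚ)) * ((h : ℚ)) * ((h : ℚ) - 2))), (((24 : ℚ) * (h : ℚ) + (-24 : ℚ) * (h : ℚ) ^ 2 + (6 : ℚ) * (h : ℚ) ^ 3) / ((6 : ℚ) * ((h : ℚ)) * ((h : ℚ)) * ((h : ℚ) - 2))), (((-12 : ℚ) * (h : ℚ) + (24 : ℚ) * (h : ℚ) ^ 2 + (-12 : ℚ) * (h : ℚ) ^ 3) / ((6 : ℚ) * ((h : ℚ)) * ((h : ℚ)) * ((h : ℚ) - 2))), (((12 : ℚ) + (-24 : ℚ) * (h : ℚ)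 + (24 : ℚ) * (h : ℚ) ^ 2 + (-18 : ℚ) * (h : ℚ) ^ 3 + (6 : ℚ) * (h : ℚ) ^ 4) / ((6 : ℚ) * ((h : ℚ)) * ((h : ℚ)) * ((h : ℚ) - 2))), (((-12 : ℚ) * (h : ℚ) ^ 2 + (18 : ℚ) * (h : ℚ) ^ 3 + (-6 : ℚ) * (h : ℚ) ^ 4) / ((6 : ℚ) * ((h : ℚ)) * ((h : ℚ)) * ((h : ℚ) - 2))), (((-72 : ℚ) + (156 : ℚ) * (h : ℚ) + (-102 : ℚ) * (h : ℚ) ^ 2 + (9 : ℚ) * (h : ℚ) ^ 3 + (12 : ℚ) * (h : ℚ) ^ 4 + (-3 : ℚ) * (h : ℚ) ^ 5) / ((6 : ℚ) * ((h : ℚ)) * ((h : ℚ)) * ((h : ℚ) - 2)))]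

/-- `kernel_T11` in the `Fin 11`-indexed shape consumed by `corner_of_certificate`. -/
theorem kernel_T11_sum (h : ℤ) (s t : ℂ) (hD0 : ((h : ℂ) - 2 : ℂ) ≠ 0) (hD1 : ((h : ℂ) : ℂ) ≠ 0)
    (hz_ms_0 : (-s : ℂ) ≠ 0) (hz_mt_0 : (-t : ℂ) ≠ 0) (hz_mu_m1 : (-s - t - 1 : ℂ) ≠ 0) (hz_ps_3 : (s + 3 : ℂ) ≠ 0) (hz_ps_2 : (s + 2 : ℂ) ≠ 0) (hz_ps_1 : (s + 1 : ℂ) ≠ 0) (hz_psh1_1 : (s + (h : ℂ) + 1 : ℂ) ≠ 0) (hz_pt_1 : (t + 1 : ℂ) ≠ 0) (hz_pth1_1 : (t + (h : ℂ) + 1 : ℂ) ≠ 0) (hz_pth1_0 : (t + (h : ℂ) : ℂ) ≠ 0) (hz_pth1_m1 : (t + (h : ℂ) - 1 : ℂ) ≠ 0) (hz_puh1_1 : (s + t + (h : ℂ) + 1 : ℂ) ≠ 0) :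
    barnesKernel ![0, 0, 0, h, h, 0, 0] ![h, 0, 0, 0, h] (s - ((0 : ℤ) : ℂ)) (t - ((0 : ℤ) : ℂ)) =
      ∑ i : Fin 11, ((ρv h i : ℝ) : ℂ) * barnesKernel (pv h i) (qv h i) (s - ((n1v i : ℤ) : ℂ)) (t - ((n2v i : ℤ) : ℂ)) := by
  simp only [Fin.sum_univ_succ, Fin.sum_univ_zero, add_zero, pv, qv, ρv, n1v, n2v,
    Matrix.cons_val_zero, Matrix.cons_val_succ, Int.cast_zero, Int.cast_one, Int.cast_ofNat, sub_zero]
  push_cast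
  rw [kernel_T11 h s t hD0 hD1 hz_ms_0 hz_mt_0 hz_mu_m1 hz_ps_3 hz_ps_2 hz_ps_1 hz_psh1_1 hz_pt_1 hz_pth1_1 hz_pth1_0 hz_pth1_m1 hz_puh1_1]
  all_goals ring

/-- **Uniform value theorem, family `T11`**: for every `h ≥ 3`, `I(a_T(h)) = Σᵢ (K_T ρᵢ(h) / Kᵢ) · I(aᵢ(h))`, from (8),(10),(16). -/
theorem corner_T11_value (h : ℤ) (hh : 3 ≤ h) (h8 : cellularIntegral_eq_cubicalIntegral) (h10 : cubicalIntegral_eq_Jintegral)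
    (hF2 : barnes_double) :
    cellularIntegral (aT h) =
      ∑ i : Fin 11, (barnesPrefactor (pT h) (qT h) * (ρv h i : ℝ) / barnesPrefactor (pv h i) (qv h i)) * cellularIntegral (av h i) := by
  have hhQ : (3 : ℚ) ≤ h := by exact_mod_cast hh
  have hhR : (3 : ℝ) ≤ h := by exact_mod_cast hh
  refine corner_of_certificate h8 h10 hF2 (aT h) (pT h) (qT h) 0 0 (av h) (pv h) (qv h) n1v n2v (ρv h)
    ((3 : ℚ) / 5) ((7 : ℚ) / 10) ?_ ?_ ?_ ?_ ?_ ?_ ?_ ?_ ?_ ?_ ?_ ?_ ?_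
  -- target: Converges / letters / nonneg / chamber
  · intro x hx; simp [convergenceForms, aT] at hx; omega
  · ext j; fin_cases j <;> simp [pOf, aT, pT] <;> ring
  · ext j; fin_cases j <;> simp [qOf, aT, qT] <;> ring
  · intro j; fin_cases j <;> simp [pT] <;> omega
  · intro j; fin_cases j <;> simp [qT] <;> omega
  · apply chamberQ_intro <;> simp [pT, qT] <;> push_cast <;> linarith
  -- support points
  · intro i; fin_cases i <;> (intro x hx; simp [convergenceForms, av] at hx; omega)
  · intro i; fin_cases i <;> (ext j; fin_cases j <;> simp [pOf, av, pv] <;> ring)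
  · intro i; fin_cases i <;> (ext j; fin_cases j <;> simp [qOf, av, qv] <;> ring)
  · intro i j; fin_cases i <;> fin_cases j <;> simp [pv] <;> omega
  · intro i j; fin_cases i <;> fin_cases j <;> simp [qv] <;> omega
  · intro i; fin_cases i <;> (apply chamberQ_intro <;> simp [pv, qv, n1v, n2v] <;> push_cast <;> linarith)
  -- kernel identity on the reference contour: the uniform certificate, shift points off the contour
  · intro y
    have hD0 : ((h : ℂ) : ℂ) ≠ 0 := by exact_mod_cast (show h ≠ 0 by omega)
    refine kernel_T11_sum h _ _ ?_ ?_ ?_ ?_ ?_ ?_ ?_ ?_ ?_ ?_ ?_ ?_ ?_ ?_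
    all_goals first
      | (apply ne_zero_of_re_ne; simp; done)
      | (apply ne_zero_of_re_ne; simp; intro hc; norm_num at hc; (try field_simp at hc); (try norm_num at hc); norm_cast at hc; omega)
      | (apply ne_zero_of_re_ne; simp; intro hc; norm_num at hc; done)
      | (exact_mod_cast (show h ≠ 0 by omega))
      | (exact_mod_cast (show h + 1 ≠ 0 by omega))
      | (exact_mod_cast (show h - 2 ≠ 0 by omega))

end Summit.KontsevichZagierPeriods.Zeta5Search.WedgeDictionary.KernelUniform.T11Value

/-! ## Family `G7` -/

namespace Summit.KontsevichZagierPeriods.Zeta5Search.WedgeDictionary.KernelUniform.G7Value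

open Literature.NumberTheory.Irrationality.BrownZudilin2022
open Summit.KontsevichZagierPeriods.Zeta5Search.WedgeDictionary.Kernel
open Summit.KontsevichZagierPeriods.Zeta5Search.WedgeDictionary.KernelUniform.G7
open Summit.KontsevichZagierPeriods.Zeta5Search.WedgeDictionary.KernelCells

/-- Target: the corner class of family `G7` as an affine parameter vector `a(h)`. -/
def aT (h X Y : ℤ) : Fin 8 → ℤ := ![0, h, 0, h, 0, X, Y, X]
/-- Its letters. -/
def pT (h X Y : ℤ) : Fin 7 → ℤ := ![0, 0, X, h, Y, 0, 0]
/-- The `q`-letters of the family's corner target. -/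
def qT (h X Y : ℤ) : Fin 5 → ℤ := ![h, 0, 0, 0, h]
/-- The 7 support points (non-corner family points), their letters and contour shifts. -/
def av (h X Y : ℤ) : Fin 7 → Fin 8 → ℤ := ![![1, h - 1, 0, h - 1, 0, X, Y, X], ![1, h - 1, 0, h - 1, 0, X + 1, Y, X + 1], ![0, h - 1, 1, h - 2, 1, X, Y, X + 1], ![1, h - 1, 1, h - 1, 1, X, Y, X + 1], ![0, h, 1, h - 1, 1, X, Y, X + 1], ![1, h, 0, h, 0, X, Y, X], ![1, h, 0, h, 0, X + 1, Y, X + 1]]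
/-- The `p`-letters of the support points. -/
def pv (h X Y : ℤ) : Fin 7 → Fin 7 → ℤ := ![![0, 0, X, h - 1, Y, 0, 1], ![0, 0, X + 1, h - 1, Y, 0, 1], ![0, 1, X, h - 1, Y, 0, 0], ![0, 0, X, h - 1, Y, 0, 0], ![0, 1, X, h, Y, 0, 0], ![0, 0, X, h, Y, 0, 1], ![0, 0, X + 1, h, Y, 0, 1]]
/-- The `q`-letters of the support points. -/
def qv (h X Y : ℤ) : Fin 7 → Fin 5 → ℤ := ![![h - 1, 0, 1, 1, h - 1], ![h - 1, 0, 1, 1, h - 1], ![h - 2, 1, 0, 0, h - 1], ![h - 1, 1, 1, 1, h - 1], ![h - 1, 1, 0, 0, h], ![h, 0, 1, 1, h], ![h, 0, 1, 1, h]]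
/-- First-variable contour shifts of the support kernels. -/
def n1v : Fin 7 → ℤ := ![0, 0, 0, 0, 0, 0, 0]
/-- Second-variable contour shifts of the support kernels. -/
def n2v : Fin 7 → ℤ := ![0, 0, 0, 0, 0, 0, 0]
/-- Certificate coefficients `ρᵢ(h) ∈ ℚ(h)`. -/
def ρv (h X Y : ℤ) : Fin 7 → ℚ := ![(((1 : ℚ) * (h : ℚ) + (1 : ℚ) * (h : ℚ) * (Y : ℚ) + (2 : ℚ) * (h : ℚ) * (X : ℚ) + (1 : ℚ) * (h : ℚ) * (X : ℚ) * (Y : ℚ) + (1 : ℚ) * (h : ℚ) * (X : ℚ) ^ 2) / (((h : ℚ)) * ((h : ℚ)))), (((-2 : ℚ) * (h : ℚ) + (-1 : ℚ) * (h : ℚ) * (Y : ℚ) + (-3 : ℚ) * (h : ℚ) * (X : ℚ) + (-1 : ℚ) * (h : ℚ) * (X : ℚ) * (Y : ℚ) + (-1 : ℚ) * (h : ℚ) * (X : ℚ) ^ 2) / (((h : ℚ)) * ((h : ℚ)))), (((1 : ℚ) * (h : ℚ) + (1 : ℚ) * (h : ℚ) * (X : ℚ)) / (((h : ℚ)) *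 ((h : ℚ)))), (((-1 : ℚ) + (-1 : ℚ) * (Y : ℚ) + (-1 : ℚ) * (X : ℚ) + (-1 : ℚ) * (X : ℚ) * (Y : ℚ) + (1 : ℚ) * (h : ℚ) + (1 : ℚ) * (h : ℚ) * (Y : ℚ) + (1 : ℚ) * (h : ℚ) * (X : ℚ) + (1 : ℚ) * (h : ℚ) * (X : ℚ) * (Y : ℚ)) / (((h : ℚ)) * ((h : ℚ)))), (((-1 : ℚ) * (h : ℚ) + (-1 : ℚ) * (h : ℚ) * (X : ℚ) + (1 : ℚ) * (h : ℚ) ^ 2) / (((h : ℚ)) * ((h : ℚ)))), (((1 : ℚ) * (X : ℚ) + (1 : ℚ) * (X : ℚ) * (Y : ℚ) + (1 : ℚ) * (X : ℚ) ^ 2 + (1 : ℚ) * (X : ℚ) ^ 2 * (Y : ℚ) + (-1 : ℚ) * (h : ℚ) + (-1 : ℚ) * (h : ℚ) * (Y : ℚ) + (-2 : ℚ) * (h : ℚ) * (X : ℚ) + (-1 : ℚ) * (h : ℚ) * (X : ℚ) * (Y : ℚ) + (-1 : ℚ) * (h : ℚ) * (X : ℚ) ^ 2 + (1 : ℚ)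 * (h : ℚ) ^ 2 + (1 : ℚ) * (h : ℚ) ^ 2 * (X : ℚ)) / (((h : ℚ)) * ((h : ℚ)))), (((-1 : ℚ) + (-1 : ℚ) * (Y : ℚ) + (-2 : ℚ) * (X : ℚ) + (-2 : ℚ) * (X : ℚ) * (Y : ℚ) + (-1 : ℚ) * (X : ℚ) ^ 2 + (-1 : ℚ) * (X : ℚ) ^ 2 * (Y : ℚ) + (2 : ℚ) * (h : ℚ) + (1 : ℚ) * (h : ℚ) * (Y : ℚ) + (3 : ℚ) * (h : ℚ) * (X : ℚ) + (1 : ℚ) * (h : ℚ) * (X : ℚ) * (Y : ℚ) + (1 : ℚ) * (h : ℚ) * (X : ℚ) ^ 2 + (-1 : ℚ) * (h : ℚ) ^ 2 + (-1 : ℚ) * (h : ℚ) ^ 2 * (X : ℚ)) / (((h : ℚ)) * ((h : ℚ))))]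

/-- `kernel_G7` in the `Fin 7`-indexed shape consumed by `corner_of_certificate`. -/
theorem kernel_G7_sum (h X Y : ℤ) (s t : ℂ) (hD0 : ((h : ℂ) : ℂ) ≠ 0)
    (hz_mu_m1 : (-s - t - 1 : ℂ) ≠ 0) (hz_ps_1 : (s + 1 : ℂ) ≠ 0) (hz_psX1_2 : (s + (X : ℂ) + 2 : ℂ) ≠ 0) (hz_psX1_1 : (s + (X : ℂ) + 1 : ℂ) ≠ 0) (hz_psh1_1 : (s + (h : ℂ) + 1 : ℂ) ≠ 0) (hz_pt_1 : (t + 1 : ℂ) ≠ 0) (hz_ptY1_2 : (t + (Y : ℂ) + 2 : ℂ) ≠ 0) (hz_ptY1_1 : (t + (Y : ℂ) + 1 : ℂ) ≠ 0) (hz_pth1_1 : (t + (h : ℂ) + 1 : ℂ) ≠ 0) (hz_puh1_1 : (s + t + (h : ℂ) + 1 : ℂ) ≠ 0) :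
    barnesKernel ![0, 0, X, h, Y, 0, 0] ![h, 0, 0, 0, h] (s - ((0 : ℤ) : ℂ)) (t - ((0 : ℤ) : ℂ)) =
      ∑ i : Fin 7, ((ρv h X Y i : ℝ) : ℂ) * barnesKernel (pv h X Y i) (qv h X Y i) (s - ((n1v i : ℤ) : ℂ)) (t - ((n2v i : ℤ) : ℂ)) := by
  simp only [Fin.sum_univ_succ, Fin.sum_univ_zero, add_zero, pv, qv, ρv, n1v, n2v,
    Matrix.cons_val_zero, Matrix.cons_val_succ, Int.cast_zero, Int.cast_one, Int.cast_ofNat, sub_zero]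
  push_cast
  rw [kernel_G7 h X Y s t hD0 hz_mu_m1 hz_ps_1 hz_psX1_2 hz_psX1_1 hz_psh1_1 hz_pt_1 hz_ptY1_2 hz_ptY1_1 hz_pth1_1 hz_puh1_1]
  all_goals ring

/-- **Uniform value theorem, family `G7`**: for every `h ≥ 3`, `I(a_T(h)) = Σᵢ (K_T ρᵢ(h) / Kᵢ) · I(aᵢ(h))`, from (8),(10),(16). -/
theorem corner_G7_value (h X Y : ℤ) (hh : 3 ≤ h) (hXY : X ≤ Y) (hY : Y ≤ h - 1) (hS : h ≤ X + Y) (hne : X + Y ≤ 2 * h - 3) (h8 : cellularIntegral_eq_cubicalIntegral) (h10 : cubicalIntegral_eq_Jintegral)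
    (hF2 : barnes_double) :
    cellularIntegral (aT h X Y) =
      ∑ i : Fin 7, (barnesPrefactor (pT h X Y) (qT h X Y) * (ρv h X Y i : ℝ) / barnesPrefactor (pv h X Y i) (qv h X Y i)) * cellularIntegral (av h X Y i) := by
  have hh_q : (3 : ℚ) ≤ h := by exact_mod_cast hh
  have hXY_q : (X : ℚ) ≤ Y := by exact_mod_cast hXY
  have hY_q : (Y : ℚ) ≤ h - 1 := by exact_mod_cast hY
  have hS_q : (h : ℚ) ≤ X + Y := by exact_mod_cast hS
  have hne_q : (X : ℚ) + Y ≤ 2 * h - 3 := by exact_mod_cast hne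
  refine corner_of_certificate h8 h10 hF2 (aT h X Y) (pT h X Y) (qT h X Y) 0 0 (av h X Y) (pv h X Y) (qv h X Y) n1v n2v (ρv h X Y)
    ((3 : ℚ) / 5) ((7 : ℚ) / 10) ?_ ?_ ?_ ?_ ?_ ?_ ?_ ?_ ?_ ?_ ?_ ?_ ?_
  -- target: Converges / letters / nonneg / chamber
  · intro x hx; simp [convergenceForms, aT] at hx; omega
  · ext j; fin_cases j <;> simp [pOf, aT, pT] <;> ring
  · ext j; fin_cases j <;> simp [qOf, aT, qT] <;> ring
  · intro j; fin_cases j <;> simp [pT] <;> omega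
  · intro j; fin_cases j <;> simp [qT] <;> omega
  · apply chamberQ_intro <;> simp [pT, qT] <;> push_cast <;> linarith
  -- support points
  · intro i; fin_cases i <;> (intro x hx; simp [convergenceForms, av] at hx; omega)
  · intro i; fin_cases i <;> (ext j; fin_cases j <;> simp [pOf, av, pv] <;> ring)
  · intro i; fin_cases i <;> (ext j; fin_cases j <;> simp [qOf, av, qv] <;> ring)
  · intro i j; fin_cases i <;> fin_cases j <;> simp [pv] <;> omega
  · intro i j; fin_cases i <;> fin_cases j <;> simp [qv] <;> omega
  · intro i; fin_cases i <;> (apply chamberQ_intro <;> simp [pv, qv, n1v, n2v] <;> push_cast <;> linarith)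
  -- kernel identity on the reference contour: the uniform certificate, shift points off the contour
  · intro y
    have hD0 : ((h : ℂ) : ℂ) ≠ 0 := by exact_mod_cast (show h ≠ 0 by omega)
    refine kernel_G7_sum h X Y _ _ ?_ ?_ ?_ ?_ ?_ ?_ ?_ ?_ ?_ ?_ ?_
    all_goals first
      | (apply ne_zero_of_re_ne; simp; done)
      | (apply ne_zero_of_re_ne; simp; intro hc; norm_num at hc; (try field_simp at hc); (try norm_num at hc); norm_cast at hc; omega)
      | (apply ne_zero_of_re_ne; simp; intro hc; norm_num at hc; done)
      | (exact_mod_cast (show h ≠ 0 by omega))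
      | (exact_mod_cast (show h + 1 ≠ 0 by omega))
      | (exact_mod_cast (show h - 2 ≠ 0 by omega))
      | (exact_mod_cast (show X + 2 ≠ 0 by omega))

end Summit.KontsevichZagierPeriods.Zeta5Search.WedgeDictionary.KernelUniform.G7Value
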